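import Literature.AlgebraicGeometry.Motives.HodgeNumberHarmonicFrames
import Literature.NumberTheory.Transcendental.KaehlerIdentityLambdaProofs
import HarnessLib

/-!
# The Hodge filtration read on harmonic representatives

Topic: Hodge theory of compact Kähler manifolds (Voisin (2002), §6.1.3). Theorems only, no new
facts.

On a compact Kähler manifold `(M, g)` every class `c ∈ H^k_dR(M; ℂ)` has a unique `Δ_d`-harmonic
representative `η` (Voisin, Thm. 5.23), whose `(p,q)`-components are again harmonic (Cor. 6.9/6.10,
the Kähler identity `Δ_d = 2Δ_∂̄`, a theorem of the tree for Hausdorff `M`: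
`cHodgeLaplacian_eq_two_smul_dolbeaultLaplacian_of_isManifold_complex_of_t2Space`). Hence, for any
set `P` of types `(p,q)`:

* `typeComponent_eq_zero_of_mem_iSup_hodgePQ` — if `c ∈ ⨆_{(p,q) ∈ P} K^{p,q}` then every
  component `η^{p',q'}` with `(p',q') ∉ P` vanishes (Prop. 6.11: the harmonic representative of a
  class of `K^{p,q}` has type `(p,q)`; linearity and uniqueness of harmonic representatives);
* `mem_iSup_hodgePQ_of_typeComponent_eq_zero` — conversely, if the components of `η` off `P`
  vanish then `c = ∑_{(p,q) ∈ P} [η^{p,q}] ∈ ⨆_{(p,q) ∈ P} K^{p,q}` (the components are harmonic,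
  hence closed, of pure type).

In particular (`mem_hodgeFiltration_iff_typeComponent_eq_zero`) **`c ∈ F^pH^k = ⨆_{p' ≥ p} K^{p',q'}`
iff the harmonic representative of `c` has no component of type `(p',q')` with `p' < p`** — the
kernel description `F^p = ker (c ↦ Π^{<p} η_c)` of the Hodge filtration used in the study of its
variation in families (Voisin, §10.2.2).

## References

* C. Voisin, *Hodge Theory and Complex Algebraic Geometry I*, CUP (2002), §5.3.1 Thm. 5.23, §6.1.2
  Thm. 6.7, Cor. 6.10, §6.1.3 Prop. 6.11 (PDF pp. 111, 120–121). [VoisinHodgeI2002] [Voisin2002]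
-/

noncomputable section

open scoped Manifold ContDiff Topology
open Bundle Module Set Finset

namespace Literature.AlgebraicGeometry.HodgeTheory

open Literature.Geometry.Kaehler Literature.NumberTheory.Transcendental
  Literature.AlgebraicGeometry.Motives

variable {E : Type*} [NormedAddCommGroup E] [NormedSpace ℂ E] [FiniteDimensional ℂ E]
  {M : Type*} [TopologicalSpace M] [ChartedSpace E M] [IsManifold 𝓘(ℝ, E) ∞ M]
  [IsManifold 𝓘(ℂ, E) ω M] [T2Space M] [CompactSpace M] {n : ℕ} [Fact (finrank ℝ E = n)]
  (g : ContMDiffRiemannianMetric 𝓘(ℝ, E) ∞ E (fun x : M ↦ TangentSpace 𝓘(ℝ, E) x))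
  (o : (x : M) → Orientation ℝ (TangentSpace 𝓘(ℝ, E) x) (Fin n))

/-- **Components of the harmonic representative vanish off the types of the class** (Voisin
(2002), §6.1.3, Prop. 6.11 with Cor. 6.10): on a compact Kähler manifold, if
`c ∈ ⨆_{(p,q) ∈ P} K^{p,q}` and `η` is the `Δ_d`-harmonic representative of `c`, then
`η^{p',q'} = 0` for every `(p',q') ∉ P`. [cite: VoisinHodgeI2002, §6.1.3 Prop. 6.11] -/
theorem typeComponent_eq_zero_of_mem_iSup_hodgePQ (hg : g.toRiemannianMetric.IsKaehler)
    {k m : ℕ} (h : k + m = n) (P : ℕ × ℕ → Prop) [DecidablePred P] :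
    letI : RiemannianBundle (fun x : M ↦ TangentSpace 𝓘(ℝ, E) x) := ⟨g.toRiemannianMetric⟩
    IsSmoothForm (riemannianVolumeForm o) →
      ∀ {c : complexDeRhamCohomology E M k},
        c ∈ ⨆ pq ∈ {pq ∈ antidiagonal k | P pq}, hodgePQ E M k pq.1 pq.2 →
        ∀ (η : cclosedSmoothForms E M k), IsCHarmonicForm o h (η : MForm 𝓘(ℝ, E) M ℂ k) →
          complexDeRhamCohomology.mk E M k η = c →
          ∀ pq' : ℕ × ℕ, ¬ P pq' → (η : MForm 𝓘(ℝ, E) M ℂ k).typeComponent pq'.1 pq'.2 = 0 := by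
  letI : RiemannianBundle (fun x : M ↦ TangentSpace 𝓘(ℝ, E) x) := ⟨g.toRiemannianMetric⟩
  haveI : IsContMDiffRiemannianBundle 𝓘(ℝ, E) ∞ E (fun x : M ↦ TangentSpace 𝓘(ℝ, E) x) :=
    ⟨g.inner, g.contMDiff, fun _ _ _ ↦ rfl⟩
  intro ho c hc η hη hηc pq' hP'
  classical
  have hK := cHodgeLaplacian_eq_two_smul_dolbeaultLaplacian_of_isManifold_complex_of_t2Space
    (k := k) (m := m) g o
  have h11 := existsUnique_isHarmonicForm_mk_eq_of_compact_of_isKaehler g o hg k m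
  -- off the antidiagonal there is nothing to prove
  by_cases hanti : pq'.1 + pq'.2 = k
  swap
  · exact MForm.typeComponent_of_ne hanti _
  -- the harmonic representative of `0` is `0`
  have hrep0 : ∀ η : cclosedSmoothForms E M k, IsCHarmonicForm o h (η : MForm 𝓘(ℝ, E) M ℂ k) →
      complexDeRhamCohomology.mk E M k η = 0 → η = 0 := fun η hη h0 ↦
    eq_of_isCHarmonicForm_of_mk_eq o ho h hη (isCHarmonicForm_zero o h) (by rw [h0, map_zero])
  -- Prop. 6.11: the harmonic representative of a class of `K^{a,b}` has type `(a,b)`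
  have htype : ∀ {a b : ℕ}, a + b = k → ∀ {c : complexDeRhamCohomology E M k},
      c ∈ hodgePQ E M k a b → ∀ η : cclosedSmoothForms E M k,
        IsCHarmonicForm o h (η : MForm 𝓘(ℝ, E) M ℂ k) → complexDeRhamCohomology.mk E M k η = c →
          IsOfType a b (η : MForm 𝓘(ℝ, E) M ℂ k) := by
    intro a b hab c hc η hη hηc
    obtain ⟨γ, hγt, hγc⟩ := exists_isOfType_mk_eq_of_mem_hodgePQ hab hc
    exact isOfType_of_isCHarmonicForm_of_mk_eq g o hK hg hab h γ.2 hγt η.2 (hηc.trans hγc.symm) ho hη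
  -- induction over the supremum
  revert η
  refine Submodule.iSup_induction
    (p := fun pq ↦ ⨆ (_ : pq ∈ {pq ∈ antidiagonal k | P pq}), hodgePQ E M k pq.1 pq.2)
    (motive := fun c ↦ ∀ η : cclosedSmoothForms E M k,
      IsCHarmonicForm o h (η : MForm 𝓘(ℝ, E) M ℂ k) → complexDeRhamCohomology.mk E M k η = c →
        (η : MForm 𝓘(ℝ, E) M ℂ k).typeComponent pq'.1 pq'.2 = 0) hc ?_ ?_ ?_
  · intro pq x hx η hη hηx
    by_cases hmem : pq ∈ {pq ∈ antidiagonal k | P pq}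
    · rw [iSup_pos hmem] at hx
      obtain ⟨hpq, hPpq⟩ := Finset.mem_filter.1 hmem
      rw [mem_antidiagonal] at hpq
      have hne : pq.1 ≠ pq'.1 ∨ pq.2 ≠ pq'.2 := by
        by_contra hcon
        push Not at hcon
        exact hP' (by rwa [show pq' = pq from Prod.ext hcon.1.symm hcon.2.symm])
      exact IsOfType.typeComponent_of_ne_holds (htype hpq hx η hη hηx) hne
    · rw [iSup_neg hmem, Submodule.mem_bot] at hx
      rw [hrep0 η hη (hηx.trans hx), Submodule.coe_zero, MForm.typeComponent_zero]
  · intro η hη hη0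
    rw [hrep0 η hη hη0, Submodule.coe_zero, MForm.typeComponent_zero]
  · intro x y hx hy η hη hηxy
    obtain ⟨ηx, hηx, rfl⟩ := exists_isCHarmonicForm_mk_eq o h11 ho h x
    obtain ⟨ηy, hηy, rfl⟩ := exists_isCHarmonicForm_mk_eq o h11 ho h y
    have hηeq : η = ηx + ηy :=
      eq_of_isCHarmonicForm_of_mk_eq o ho h hη (hηx.add o ho h hηy) (by rw [hηxy, map_add])
    rw [hηeq, Submodule.coe_add, MForm.typeComponent_add, hx ηx hηx rfl, hy ηy hηy rfl, add_zero]

/-- **A class whose harmonic representative has only types in `P` lies in `⨆_{(p,q) ∈ P} K^{p,q}`**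
(Voisin (2002), §6.1.3, the decomposition of p. 121 with Cor. 6.10): the components `η^{p,q}` of
the `Δ_d`-harmonic `η` are harmonic, hence closed, of pure type, and `[η] = ∑_{(p,q) ∈ P} [η^{p,q}]`
when the other components vanish. [cite: VoisinHodgeI2002, §6.1.3 (p. 121)] -/
theorem mem_iSup_hodgePQ_of_typeComponent_eq_zero (hg : g.toRiemannianMetric.IsKaehler)
    {k m : ℕ} (h : k + m = n) (P : ℕ × ℕ → Prop) [DecidablePred P] :
    letI : RiemannianBundle (fun x : M ↦ TangentSpace 𝓘(ℝ, E) x) := ⟨g.toRiemannianMetric⟩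
    IsSmoothForm (riemannianVolumeForm o) →
      ∀ (η : cclosedSmoothForms E M k), IsCHarmonicForm o h (η : MForm 𝓘(ℝ, E) M ℂ k) →
        (∀ pq' ∈ antidiagonal k, ¬ P pq' →
          (η : MForm 𝓘(ℝ, E) M ℂ k).typeComponent pq'.1 pq'.2 = 0) →
        complexDeRhamCohomology.mk E M k η ∈
          ⨆ pq ∈ {pq ∈ antidiagonal k | P pq}, hodgePQ E M k pq.1 pq.2 := by
  letI : RiemannianBundle (fun x : M ↦ TangentSpace 𝓘(ℝ, E) x) := ⟨g.toRiemannianMetric⟩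
  haveI : IsContMDiffRiemannianBundle 𝓘(ℝ, E) ∞ E (fun x : M ↦ TangentSpace 𝓘(ℝ, E) x) :=
    ⟨g.inner, g.contMDiff, fun _ _ _ ↦ rfl⟩
  intro ho η hη hzero
  classical
  have hK := cHodgeLaplacian_eq_two_smul_dolbeaultLaplacian_of_isManifold_complex_of_t2Space
    (k := k) (m := m) g o
  -- Cor. 6.9: the type components of a `Δ_d`-harmonic form are `Δ_d`-harmonic
  have hT : ∀ (a b : ℕ) {α : MForm 𝓘(ℝ, E) M ℂ k},
      IsCHarmonicForm o h α → IsCHarmonicForm o h (α.typeComponent a b) := fun a b α hα ↦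
    (mem_charmonicForms_iff_of_contMDiffMetric o ho h _).1
      (typeComponent_mem_charmonicForms_of_kaehlerIdentity g o hK hg h a b ho (hα.mem_charmonicForms o))
  have hclosed : ∀ pq : ℕ × ℕ,
      (η : MForm 𝓘(ℝ, E) M ℂ k).typeComponent pq.1 pq.2 ∈ cclosedSmoothForms E M k :=
    fun pq ↦ (mem_cclosedSmoothForms_iff _).2
      ⟨(hT _ _ hη).1, mextDeriv_eq_zero_of_isCHarmonicForm o ho h (hT _ _ hη)⟩
  -- `η = ∑_{(p,q) ∈ P} η^{p,q}` as closed forms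
  have hηF : η = ∑ pq ∈ {pq ∈ antidiagonal k | P pq},
      (⟨(η : MForm 𝓘(ℝ, E) M ℂ k).typeComponent pq.1 pq.2, hclosed pq⟩ : cclosedSmoothForms E M k) := by
    apply Subtype.ext
    rw [Submodule.coe_sum]
    conv_lhs => rw [← sum_antidiagonal_typeComponent_holds (η : MForm 𝓘(ℝ, E) M ℂ k)]
    rw [← Finset.sum_filter_add_sum_filter_not (antidiagonal k) P]
    have hvan : ∑ pq ∈ (antidiagonal k).filter (fun pq ↦ ¬ P pq),
        (η : MForm 𝓘(ℝ, E) M ℂ k).typeComponent pq.1 pq.2 = 0 :=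
      Finset.sum_eq_zero fun pq hpq ↦
        hzero pq (Finset.mem_filter.1 hpq).1 (Finset.mem_filter.1 hpq).2
    rw [hvan, add_zero]
  rw [hηF, map_sum]
  refine Submodule.sum_mem _ fun pq hpq ↦ ?_
  refine Submodule.mem_iSup_of_mem pq (Submodule.mem_iSup_of_mem hpq ?_)
  have hpqk : pq.1 + pq.2 = k := mem_antidiagonal.1 (Finset.mem_filter.1 hpq).1
  exact Submodule.subset_span ⟨_, isOfType_typeComponent_holds hpqk _, rfl⟩

/-- **The Hodge filtration on harmonic representatives**: on a compact Kähler manifold, for the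
`Δ_d`-harmonic representative `η` of a class `c ∈ H^k_dR(M; ℂ)`,
`c ∈ F^pH^k = ⨆_{p' + q' = k, p ≤ p'} K^{p',q'}` **iff** `η^{p',q'} = 0` for all `p' < p`
(Voisin (2002), §6.1.3 Prop. 6.11 and p. 121; the filtration `F^p = ⊕_{p' ≥ p} H^{p',q'}` of
§7.1.1). [cite: VoisinHodgeI2002, §6.1.3 Prop. 6.11] -/
theorem mem_hodgeFiltration_iff_typeComponent_eq_zero (hg : g.toRiemannianMetric.IsKaehler)
    {k m : ℕ} (h : k + m = n) (p : ℕ) :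
    letI : RiemannianBundle (fun x : M ↦ TangentSpace 𝓘(ℝ, E) x) := ⟨g.toRiemannianMetric⟩
    IsSmoothForm (riemannianVolumeForm o) →
      ∀ (η : cclosedSmoothForms E M k), IsCHarmonicForm o h (η : MForm 𝓘(ℝ, E) M ℂ k) →
        (complexDeRhamCohomology.mk E M k η ∈
            ⨆ pq ∈ {pq ∈ antidiagonal k | p ≤ pq.1}, hodgePQ E M k pq.1 pq.2 ↔
          ∀ r s, r < p → (η : MForm 𝓘(ℝ, E) M ℂ k).typeComponent r s = 0) := by
  intro ho η hη
  constructor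
  · intro hc r s hr
    exact typeComponent_eq_zero_of_mem_iSup_hodgePQ g o hg h (fun pq ↦ p ≤ pq.1) ho hc η hη rfl
      (r, s) (by simpa using hr)
  · intro hzero
    refine mem_iSup_hodgePQ_of_typeComponent_eq_zero g o hg h (fun pq ↦ p ≤ pq.1) ho η hη ?_
    intro pq _ hP
    exact hzero pq.1 pq.2 (by simpa using hP)

end Literature.AlgebraicGeometry.HodgeTheory
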